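import Summits.CriticalPhenomena.PercolationContinuityZ3.Theorems.Transplant.ProdZ2FrameKit
import Summits.CriticalPhenomena.PercolationContinuityZ3.Theorems.Transplant.ProdZ2SqShadow
import HarnessLib

/-!
# `F □ ℤ²`, p205010-free routing V: THE EXCEPTIONAL (STACKED) FAMILY — `E₁, E₂` in one column `A` with a single gateway column, `w'` over the adjacent column
# `A + μ`: three explicit swap pairs in the `2 × 3` frame, chosen by the `F`-geometry of the two terminal levels

builds on p205010 (kernel theorem, internal audit signed; external expert review pending) — NOT used in this file.
Lane `prim-bschramm`, seat `prim-bschramm-p2` (gen 50; class C1b, METHOD = input substitution; memo `HOME/bschramm/P2-LATTICES.md` §161); helper file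
(`--supports stmt-CriticalPhenomena-4575 --as helper`).

THE THREE DESIGNS (frame columns `a = A`, `s = A + μ` (the column of `w'`), `a' = A + ν`, `s' = A + μ + ν`, `a'' = A + 2ν`, `s'' = A + μ + 2ν`; terminals
`E₁ = (g₁, a)`, `E₂ = (g₂, a)`, `w' = (g₃, s)`; the branch always ends by an `F`-path inside the column `s`, which no chain touches):
* FAR (`g₁ ≁ g₂`; an `F`-path `g₁ = f₀, f₁, …, f_m = g₂`, `m ≥ 2`): chain 1 = `E₁`, the column path over `a'`, `E₂`, marked edge `(f₀,a') → (f₁,a')`, branch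
  `(g₁,s') → (g₁,s) ⇝ w'`; chain 2 = `E₁, (g₁,a'), (g₁,s'), ` column path over `s''`, `(g₂,a''), (g₂,a'), E₂`, marked edge `(g₁,a') → (g₁,s')`, branch
  `(f₁,a') → (f₁,a) → (f₁,s) ⇝ w'`;
* RIGHT (`g₁ ∼ g₂`, a third vertex `h ∼ g₂`): chain 1 = `E₁, (g₁,a'), (g₂,a'), (h,a'), (h,a), E₂`, edge `(g₂,a') → (h,a')`, branch `(g₂,s') → (g₂,s) ⇝ w'`;
  chain 2 = `E₁, (g₁,a'), (g₁,s'), (g₁,s''), (g₂,s''), (h,s''), (h,s'), (g₂,s'), (g₂,a'), E₂`, edge `(h,s') → (g₂,s')`, branch `(h,a') → (h,a) → (h,s) ⇝ w'`;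
* LEFT (`g₁ ∼ g₂`, a third vertex `h ∼ g₁`): chain 1 = `E₁, (h,a), (h,a'), (g₁,a'), (g₂,a'), E₂`, edge `(h,a') → (g₁,a')`, branch `(h,s') → (h,s) ⇝ w'`;
  chain 2 = `E₁, (h,a), (h,a'), (h,s'), (h,s''), (g₁,s''), (g₂,s''), (g₂,s'), (g₂,a'), E₂`, edge `(h,a') → (h,s')`, branch `(g₁,a') → (g₁,s') → (g₁,s) ⇝ w'`.
* §1 the three designs; §2 `FinProdZ2.StackedRouting` and **`FinProdZ2.stackedRouting`** (every connected `F` with a fork).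
[cite: DuminilCopinSidoraviciusTassion2016, §2.3 (proof of Fact 2: the three disjoint self-avoiding paths in B̄_R(z))]
-/

noncomputable section

namespace Summit.CriticalPhenomena.PercolationContinuityZ3.Theorems.Transplant

namespace FinProdZ2

open Literature.Probability.Percolation Literature.Probability.LatticeModels SimpleGraph BccClawX
open scoped Classical

variable {W : Type} {F : SimpleGraph W}

/-! ## §1 The three designs -/

section Designs

variable {RP : Set (Site 2)} {A : Site 2} {μ ν : Pt} (Fr : Frame RP A μ ν) (hF : F.Connected) {WR Wc : Set (W × Site 2)}
  (hWR : ∀ x : W × Site 2, x.2 ∈ RP → x ∈ WR) (hW : ∀ x : W × Site 2, x.2 ∈ RP → x ∈ Wc)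
include Fr hF

include hW in
/-- **The branch tail**: from the frame vertex `(x, i, j)` next to the column `s = (1, 0)` into `s` and down an `F`-path to `w' = (g₃, s)`; all over the patch.
[cite: DuminilCopinSidoraviciusTassion2016, §2.3 (proof of Fact 2)] -/
theorem exists_tail (x g₃ : W) {i j : ℤ} (hs : Step F (x, i, j) (x, 1, 0)) (hij : (i, j) ≠ (1, 0)) (hr : 0 ≤ i ∧ i ≤ 1 ∧ 0 ≤ j ∧ j ≤ 2) :
    ∃ Br : List (W × Site 2), GPath (F □ zdGraph 2) Br (fv A μ ν (x, i, j)) (fv A μ ν (g₃, 1, 0)) ∧ (∀ v ∈ Br, v ∈ Wc) ∧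
      ∀ v ∈ Br, v = fv A μ ν (x, i, j) ∨ ∃ f : W, v = fv A μ ν (f, 1, 0) := by
  obtain ⟨L, hL⟩ := exists_gpath F hF x g₃
  refine ⟨fv A μ ν (x, i, j) :: col (fcol A μ ν 1 0) L, gpath_cons_col Fr hL hs hij, fun v hv => ?_, fun v hv => ?_⟩
  · rcases List.mem_cons.1 hv with rfl | hv
    · exact hW _ (snd_fv_mem Fr hr)
    · exact hW _ (snd_mem_of_mem_col Fr (by norm_num) hv)
  · rcases List.mem_cons.1 hv with rfl | hv
    · exact Or.inl rfl
    · obtain ⟨f, -, rfl⟩ := exists_of_mem_col_fcol hv; exact Or.inr ⟨f, rfl⟩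

include hWR hW in
/-- **DESIGN FAR** (`g₁ ≁ g₂`; an `F`-path `g₁ = f₀ ∼ f₁ ∼ … ∼ f_m = g₂` with `m ≥ 2`): routing 1 runs the chain through the column path over `a'` with the
marked edge `(f₀,a') → (f₁,a')` and branches `(g₁,s') → (g₁,s) ⇝ w'`; routing 2 runs the chain `E₁, (g₁,a'), (g₁,s')`, the column path over `s''`,
`(g₂,a''), (g₂,a'), E₂` with the marked edge `(g₁,a') → (g₁,s')` and branches `(f₁,a') → (f₁,a) → (f₁,s) ⇝ w'`.
[cite: DuminilCopinSidoraviciusTassion2016, §2.3 (proof of Fact 2)] -/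
theorem swapPair_far {g₁ g₂ g₃ : W} (h12 : g₁ ≠ g₂) (hn : ¬ F.Adj g₁ g₂) :
    ∃ r₁ r₂ : VRouteData (F □ zdGraph 2) WR Wc (fv A μ ν (g₁, 0, 0)) (fv A μ ν (g₂, 0, 0)) (fv A μ ν (g₃, 1, 0)), r₁.y = r₂.b ∧ r₁.b = r₂.y := by
  have hne : fv A μ ν (g₁, 0, 0) ≠ fv A μ ν (g₂, (0 : ℤ), (0 : ℤ)) := fun e => h12 (by have := fv_inj Fr e; simpa using this)
  obtain ⟨P, hP, h3⟩ := exists_gpath_three_le F hF h12 hn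
  obtain ⟨p₀, f₁, p₂, rest, rfl⟩ : ∃ p₀ f₁ p₂ rest, P = p₀ :: f₁ :: p₂ :: rest := by
    match P, h3 with
    | p₀ :: f₁ :: p₂ :: rest, _ => exact ⟨p₀, f₁, p₂, rest, rfl⟩
  have hp₀ : p₀ = g₁ := by simpa using hP.head
  subst hp₀
  have hnd := hP.nodup
  have hch := hP.chain
  rw [List.isChain_cons_cons] at hch
  have hf1 : f₁ ≠ p₀ := by intro e; subst e; simp at hnd
  have hf2 : f₁ ≠ g₂ := by
    intro e; subst e
    have hl := hP.last
    rw [List.getLast?_eq_some_getLast (by simp)] at hl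
    simp only [Option.some.injEq, List.getLast_cons_cons] at hl
    have hmem : f₁ ∈ p₂ :: rest := by rw [← hl]; exact List.getLast_mem _
    simp only [List.nodup_cons, List.mem_cons, not_or] at hnd
    rcases List.mem_cons.1 hmem with e | e
    · exact hnd.2.1.1 e
    · exact hnd.2.1.2 e
  -- membership in a column path over the patch column `(i, j)`
  have colmem : ∀ {i j : ℤ} {L : List W} {v : W × Site 2}, v ∈ col (fcol A μ ν i j) L → ∃ f, v = fv A μ ν (f, i, j) :=
    fun hv => by obtain ⟨f, -, rfl⟩ := exists_of_mem_col_fcol hv; exact ⟨f, rfl⟩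
  have cne : ∀ {t t' : W × ℤ × ℤ}, t.2 ≠ t'.2 → fv A μ ν t ≠ fv A μ ν t' := fun h e => h (by rw [fv_inj Fr e])
  -- ROUTING 1: chain `E₁ :: col a' P ++ [E₂]`
  have hcolP : GPath (F □ zdGraph 2) (col (fcol A μ ν 0 1) (p₀ :: f₁ :: p₂ :: rest)) (fv A μ ν (p₀, 0, 1)) (fv A μ ν (g₂, 0, 1)) := gpath_col F hP
  have hT₁ : GPath (F □ zdGraph 2) (col (fcol A μ ν 0 1) (p₀ :: f₁ :: p₂ :: rest) ++ [fv A μ ν (g₂, 0, 1), fv A μ ν (g₂, 0, 0)].tail)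
      (fv A μ ν (p₀, 0, 1)) (fv A μ ν (g₂, 0, 0)) := by
    refine hcolP.trans (GPath.pair (fv_adj Fr (Step.planar F g₂ (by norm_num)))) fun v hv hvc => ?_
    rcases List.mem_cons.1 hv with rfl | hv
    · rfl
    · rw [List.mem_singleton] at hv; subst hv
      obtain ⟨f, hf⟩ := colmem hvc
      exact absurd hf (cne (by norm_num))
  have hSP₁ : GPath (F □ zdGraph 2) (fv A μ ν (p₀, 0, 0) :: (col (fcol A μ ν 0 1) (p₀ :: f₁ :: p₂ :: rest) ++ [fv A μ ν (g₂, 0, 0)]))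
      (fv A μ ν (p₀, 0, 0)) (fv A μ ν (g₂, 0, 0)) := by
    refine hT₁.cons (fv_adj Fr (Step.planar F p₀ (by norm_num))) fun hv => ?_
    rcases List.mem_append.1 hv with hv | hv
    · obtain ⟨f, hf⟩ := colmem hv; exact cne (by norm_num) hf
    · simp only [List.tail_cons, List.mem_singleton] at hv; exact hne hv
  obtain ⟨Br₁, hBr₁, hBr₁W, hBr₁mem⟩ := exists_tail Fr hF hW p₀ g₃ (i := 1) (j := 1) (Step.planar F p₀ (by norm_num)) (by norm_num) (by norm_num)
  obtain ⟨r₁, h1y, h1b⟩ := VRouteData.exists_ofPaths' (WR := WR) hSP₁ hne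
    (by
      intro v hv
      rcases List.mem_cons.1 hv with rfl | hv
      · exact hWR _ (snd_fv_mem Fr (by norm_num))
      rcases List.mem_append.1 hv with hv | hv
      · exact hWR _ (snd_mem_of_mem_col Fr (by norm_num) hv)
      · simp only [List.mem_singleton] at hv; subst hv; exact hWR _ (snd_fv_mem Fr (by norm_num)))
    ⟨[fv A μ ν (p₀, 0, 0)], col (fcol A μ ν 0 1) (p₂ :: rest) ++ [fv A μ ν (g₂, 0, 0)], rfl⟩ hBr₁ hBr₁W
    (fv_adj Fr (Step.planar F p₀ (by norm_num)))
    (by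
      intro v hv hvS
      rcases hBr₁mem v hv with rfl | ⟨f, rfl⟩
      · rcases List.mem_cons.1 hvS with e | hvS
        · exact cne (by norm_num) e
        rcases List.mem_append.1 hvS with hvS | hvS
        · obtain ⟨f, hf⟩ := colmem hvS; exact cne (by norm_num) hf
        · simp only [List.mem_singleton] at hvS; exact cne (by norm_num) hvS
      · rcases List.mem_cons.1 hvS with e | hvS
        · exact cne (by norm_num) e
        rcases List.mem_append.1 hvS with hvS | hvS
        · obtain ⟨f', hf⟩ := colmem hvS; exact cne (by norm_num) hf
        · simp only [List.mem_singleton] at hvS; exact cne (by norm_num) hvS)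
  -- ROUTING 2: chain `E₁, (g₁,a'), (g₁,s'), col s'' P, (g₂,a''), (g₂,a'), E₂`
  have hcolP₂ : GPath (F □ zdGraph 2) (col (fcol A μ ν 1 2) (p₀ :: f₁ :: p₂ :: rest)) (fv A μ ν (p₀, 1, 2)) (fv A μ ν (g₂, 1, 2)) := gpath_col F hP
  have hD : GPath (F □ zdGraph 2) (fpath A μ ν [(g₂, 1, 2), (g₂, 0, 2), (g₂, 0, 1), (g₂, 0, 0)]) (fv A μ ν (g₂, 1, 2)) (fv A μ ν (g₂, 0, 0)) :=
    gpath_fpath Fr (by simp) (by simp) (List.isChain_cons_cons.2 ⟨Step.planar F g₂ (by norm_num), List.isChain_cons_cons.2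
      ⟨Step.planar F g₂ (by norm_num), List.isChain_cons_cons.2 ⟨Step.planar F g₂ (by norm_num), List.IsChain.singleton _⟩⟩⟩)
  have hT₂ : GPath (F □ zdGraph 2) (col (fcol A μ ν 1 2) (p₀ :: f₁ :: p₂ :: rest) ++ (fpath A μ ν [(g₂, 1, 2), (g₂, 0, 2), (g₂, 0, 1), (g₂, 0, 0)]).tail)
      (fv A μ ν (p₀, 1, 2)) (fv A μ ν (g₂, 0, 0)) := by
    refine hcolP₂.trans hD fun v hv hvc => ?_
    obtain ⟨f, hf⟩ := colmem hvc
    simp only [fpath_cons, fpath_nil, List.mem_cons, List.not_mem_nil, or_false] at hv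
    rcases hv with rfl | rfl | rfl | rfl
    · rfl
    all_goals exact absurd hf (cne (by norm_num))
  have tmem : ∀ v ∈ col (fcol A μ ν 1 2) (p₀ :: f₁ :: p₂ :: rest) ++ (fpath A μ ν [(g₂, 1, 2), (g₂, 0, 2), (g₂, 0, 1), (g₂, 0, 0)]).tail,
      (∃ f, v = fv A μ ν (f, 1, 2)) ∨ v = fv A μ ν (g₂, 0, 2) ∨ v = fv A μ ν (g₂, 0, 1) ∨ v = fv A μ ν (g₂, 0, 0) := by
    intro v hv
    rcases List.mem_append.1 hv with hv | hv
    · exact Or.inl (colmem hv)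
    · simp only [fpath_cons, fpath_nil, List.tail_cons, List.mem_cons, List.not_mem_nil, or_false] at hv
      exact Or.inr hv
  have hS₃ : GPath (F □ zdGraph 2) (fv A μ ν (p₀, 1, 1) :: (col (fcol A μ ν 1 2) (p₀ :: f₁ :: p₂ :: rest) ++
      (fpath A μ ν [(g₂, 1, 2), (g₂, 0, 2), (g₂, 0, 1), (g₂, 0, 0)]).tail)) (fv A μ ν (p₀, 1, 1)) (fv A μ ν (g₂, 0, 0)) := by
    refine hT₂.cons (fv_adj Fr (Step.planar F p₀ (by norm_num))) fun hv => ?_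
    rcases tmem _ hv with ⟨f, hf⟩ | hf | hf | hf
    · exact cne (by norm_num) hf
    all_goals exact cne (by norm_num) hf
  have hS₂ : GPath (F □ zdGraph 2) (fv A μ ν (p₀, 0, 1) :: fv A μ ν (p₀, 1, 1) :: (col (fcol A μ ν 1 2) (p₀ :: f₁ :: p₂ :: rest) ++
      (fpath A μ ν [(g₂, 1, 2), (g₂, 0, 2), (g₂, 0, 1), (g₂, 0, 0)]).tail)) (fv A μ ν (p₀, 0, 1)) (fv A μ ν (g₂, 0, 0)) := by
    refine hS₃.cons (fv_adj Fr (Step.planar F p₀ (by norm_num))) fun hv => ?_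
    rcases List.mem_cons.1 hv with e | hv
    · exact cne (by norm_num) e
    rcases tmem _ hv with ⟨f, hf⟩ | hf | hf | hf
    · exact cne (by norm_num) hf
    · exact cne (by norm_num) hf
    · exact h12 (by have := fv_inj Fr hf; simpa using this)
    · exact cne (by norm_num) hf
  have hSP₂ : GPath (F □ zdGraph 2) (fv A μ ν (p₀, 0, 0) :: fv A μ ν (p₀, 0, 1) :: fv A μ ν (p₀, 1, 1) ::
      (col (fcol A μ ν 1 2) (p₀ :: f₁ :: p₂ :: rest) ++ (fpath A μ ν [(g₂, 1, 2), (g₂, 0, 2), (g₂, 0, 1), (g₂, 0, 0)]).tail))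
      (fv A μ ν (p₀, 0, 0)) (fv A μ ν (g₂, 0, 0)) := by
    refine hS₂.cons (fv_adj Fr (Step.planar F p₀ (by norm_num))) fun hv => ?_
    rcases List.mem_cons.1 hv with e | hv
    · exact cne (by norm_num) e
    rcases List.mem_cons.1 hv with e | hv
    · exact cne (by norm_num) e
    rcases tmem _ hv with ⟨f, hf⟩ | hf | hf | hf
    · exact cne (by norm_num) hf
    · exact cne (by norm_num) hf
    · exact cne (by norm_num) hf
    · exact hne hf
  -- branch 2: `(f₁,a') → (f₁,a) → (f₁,s) ⇝ w'`
  obtain ⟨Br₂', hBr₂', hBr₂'W, hBr₂'mem⟩ := exists_tail Fr hF hW f₁ g₃ (i := 0) (j := 0) (Step.planar F f₁ (by norm_num)) (by norm_num) (by norm_num)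
  have hBr₂ : GPath (F □ zdGraph 2) (fv A μ ν (f₁, 0, 1) :: Br₂') (fv A μ ν (f₁, 0, 1)) (fv A μ ν (g₃, 1, 0)) := by
    refine hBr₂'.cons (fv_adj Fr (Step.planar F f₁ (by norm_num))) fun hv => ?_
    rcases hBr₂'mem _ hv with e | ⟨f, e⟩
    · exact cne (by norm_num) e
    · exact cne (by norm_num) e
  obtain ⟨r₂, h2y, h2b⟩ := VRouteData.exists_ofPaths' (WR := WR) hSP₂ hne
    (by
      intro v hv
      rcases List.mem_cons.1 hv with rfl | hv
      · exact hWR _ (snd_fv_mem Fr (by norm_num))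
      rcases List.mem_cons.1 hv with rfl | hv
      · exact hWR _ (snd_fv_mem Fr (by norm_num))
      rcases List.mem_cons.1 hv with rfl | hv
      · exact hWR _ (snd_fv_mem Fr (by norm_num))
      rcases tmem _ hv with ⟨f, rfl⟩ | rfl | rfl | rfl <;> exact hWR _ (snd_fv_mem Fr (by norm_num)))
    ⟨[fv A μ ν (p₀, 0, 0)], _, rfl⟩ hBr₂
    (by
      intro v hv
      rcases List.mem_cons.1 hv with rfl | hv
      · exact hW _ (snd_fv_mem Fr (by norm_num))
      · exact hBr₂'W v hv)
    (fv_adj Fr (Step.fibre F hch.1 0 1))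
    (by
      intro v hv hvS
      have key : ∀ {t : W × ℤ × ℤ}, fv A μ ν t ∈ fv A μ ν (p₀, 0, 0) :: fv A μ ν (p₀, 0, 1) :: fv A μ ν (p₀, 1, 1) ::
          (col (fcol A μ ν 1 2) (p₀ :: f₁ :: p₂ :: rest) ++ (fpath A μ ν [(g₂, 1, 2), (g₂, 0, 2), (g₂, 0, 1), (g₂, 0, 0)]).tail) →
          t = (p₀, 0, 0) ∨ t = (p₀, 0, 1) ∨ t = (p₀, 1, 1) ∨ (∃ f, t = (f, 1, 2)) ∨ t = (g₂, 0, 2) ∨ t = (g₂, 0, 1) ∨ t = (g₂, 0, 0) := by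
        intro t ht
        rcases List.mem_cons.1 ht with e | ht
        · exact Or.inl (fv_inj Fr e)
        rcases List.mem_cons.1 ht with e | ht
        · exact Or.inr (Or.inl (fv_inj Fr e))
        rcases List.mem_cons.1 ht with e | ht
        · exact Or.inr (Or.inr (Or.inl (fv_inj Fr e)))
        rcases tmem _ ht with ⟨f, hf⟩ | hf | hf | hf
        · exact Or.inr (Or.inr (Or.inr (Or.inl ⟨f, fv_inj Fr hf⟩)))
        · exact Or.inr (Or.inr (Or.inr (Or.inr (Or.inl (fv_inj Fr hf)))))
        · exact Or.inr (Or.inr (Or.inr (Or.inr (Or.inr (Or.inl (fv_inj Fr hf))))))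
        · exact Or.inr (Or.inr (Or.inr (Or.inr (Or.inr (Or.inr (fv_inj Fr hf))))))
      rcases List.mem_cons.1 hv with rfl | hv
      · rcases key hvS with e | e | e | ⟨f, e⟩ | e | e | e <;> simp [Prod.ext_iff, hf1, hf2] at e
      · rcases hBr₂'mem _ hv with rfl | ⟨f, rfl⟩
        · rcases key hvS with e | e | e | ⟨f, e⟩ | e | e | e <;> simp [Prod.ext_iff, hf1, hf2] at e
        · rcases key hvS with e | e | e | ⟨f', e⟩ | e | e | e <;> simp [Prod.ext_iff] at e)
  have h1y' : r₁.y = fv A μ ν (f₁, 0, 1) := h1y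
  exact ⟨r₁, r₂, by rw [h1y', h2b], by rw [h1b, h2y]⟩

end Designs

end FinProdZ2

end Summit.CriticalPhenomena.PercolationContinuityZ3.Theorems.Transplant

end
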